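import Summits.NavierStokesRegularity.NavierStokesRegularity.Theorems.TypeILiouvilleTypeIliouvilleLWeakL3TailOfLp
import HarnessLib

/-!
# `L³` recurrence to one constant implies weak-`L³` recurrence with a vanishing tail (crux
# `TypeIliouvilleL`, stmt-NavierStokesRegularity-10661, persistent stub S3ᵐ): S3ᵐ₁ ⇒ S3ʷ

Helper file (theorems only, no definition, no named fact, no `sorry`; lands
`--supports stmt-NavierStokesRegularity-10661`). The conclusion of the registered persistent stub
S3ᵐ with ONE constant (`‖v(τ_k) − b‖_{L³} ≤ M'` along `τ_k → −∞`; "S3ᵐ₁", to which S3ᵐ reduces by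
constant propagation) implies the WEAK-`L³` / VANISHING-TAIL conclusion S3ʷ used by
`…WeakL3VanishingTail` / `…WeakL3TailRecurrence`: Chebyshev gives the uniform weak-`L³` bound
`s³·vol{s < ‖v(τ_k) − b‖} ≤ M'³`, and the `L³` slice at `k₀ = 0` has vanishing lower tail
(`tendsto_cube_mul_meas_lt_of_memLp_three`). So S3ʷ is a weaker-or-equal proof obligation than
S3ᵐ₁, with the same kill. Nothing here proves S3ᵐ, S3ʷ, (L), or anything about Navier–Stokes
regularity.
-/

set_option linter.dupNamespace false

namespace Summit.NavierStokesRegularity.NavierStokesRegularity.Theorems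

open MeasureTheory Filter Set Function Metric
open scoped ENNReal NNReal Topology
open Literature.Analysis Literature.Analysis.FluidPDE

/-- **Chebyshev in the hand's raw weak-`L³` form**: for an a.e.-strongly measurable `f : ℝ³ → F`
and every real level `s`, `(s⁺)³ · vol{x : s < ‖f x‖} ≤ ‖f‖³_{L³}`. [cite: Grafakos2014, Prop. 1.1.6 (Chebyshev)] -/
theorem cube_mul_meas_lt_le_eLpNorm_three_pow {F : Type*} [NormedAddCommGroup F]
    {f : EuclideanSpace ℝ (Fin 3) → F} (hf : AEStronglyMeasurable f volume) (s : ℝ) :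
    ENNReal.ofReal s ^ 3 * (volume : Measure (EuclideanSpace ℝ (Fin 3))) {x | s < ‖f x‖} ≤
      eLpNorm f 3 volume ^ 3 := by
  have hsub : {x : EuclideanSpace ℝ (Fin 3) | s < ‖f x‖} ⊆ {x | ENNReal.ofReal s ≤ ‖f x‖ₑ} := by
    intro x hx
    simp only [mem_setOf_eq] at hx ⊢
    rw [← ofReal_norm]
    exact ENNReal.ofReal_le_ofReal hx.le
  have h1 := mul_meas_ge_le_pow_eLpNorm' volume (by norm_num : (3 : ℝ≥0∞) ≠ 0)
    (by norm_num : (3 : ℝ≥0∞) ≠ ∞) hf (ENNReal.ofReal s)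
  have h3 : ((3 : ℝ≥0∞).toReal) = ((3 : ℕ) : ℝ) := by norm_num
  rw [h3, ENNReal.rpow_natCast, ENNReal.rpow_natCast] at h1
  calc ENNReal.ofReal s ^ 3 * (volume : Measure (EuclideanSpace ℝ (Fin 3))) {x | s < ‖f x‖}
      ≤ ENNReal.ofReal s ^ 3 * volume {x | ENNReal.ofReal s ≤ ‖f x‖ₑ} := by gcongr
    _ ≤ eLpNorm f 3 volume ^ 3 := h1

/-- **S3ᵐ₁ ⇒ S3ʷ**: `L³` recurrence to ONE constant along `τ_k` (`‖v(τ_k) − b‖_{L³} ≤ M'`, slices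
a.e.-strongly measurable) yields the weak-`L³` recurrence data of `…WeakL3TailRecurrence`: the
uniform bound `s³·vol{s < ‖v(τ_k) − b‖} ≤ M'³` for all `s > 0`, `k`, and a vanishing lower tail at
`k₀ = 0`. [cite: Grafakos2014, Prop. 1.1.6 (Chebyshev)] -/
theorem weakL3TailRecurrence_of_L3Recurrence_oneConst
    (v : ℝ → EuclideanSpace ℝ (Fin 3) → EuclideanSpace ℝ (Fin 3)) (b : EuclideanSpace ℝ (Fin 3))
    (τ : ℕ → ℝ) {M' : ℝ≥0}
    (hmeas : ∀ k, AEStronglyMeasurable (fun x => v (τ k) x - b) volume)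
    (hL3 : ∀ k, eLpNorm (fun x => v (τ k) x - b) 3 (volume : Measure (EuclideanSpace ℝ (Fin 3))) ≤
      (M' : ℝ≥0∞)) :
    ∃ (M : ℝ≥0) (k₀ : ℕ),
      (∀ (k : ℕ) (s : ℝ), 0 < s →
        ENNReal.ofReal s ^ 3 *
          (volume : Measure (EuclideanSpace ℝ (Fin 3))) {x | s < ‖v (τ k) x - b‖} ≤ (M : ℝ≥0∞)) ∧
      Tendsto (fun s : ℝ => ENNReal.ofReal s ^ 3 *
          (volume : Measure (EuclideanSpace ℝ (Fin 3))) {x | s < ‖v (τ k₀) x - b‖})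
        (𝓝[>] 0) (𝓝 0) := by
  refine ⟨M' ^ 3, 0, fun k s _ => ?_, ?_⟩
  · calc ENNReal.ofReal s ^ 3 *
          (volume : Measure (EuclideanSpace ℝ (Fin 3))) {x | s < ‖v (τ k) x - b‖}
        ≤ eLpNorm (fun x => v (τ k) x - b) 3 volume ^ 3 :=
          cube_mul_meas_lt_le_eLpNorm_three_pow (hmeas k) s
      _ ≤ (M' : ℝ≥0∞) ^ 3 := by gcongr; exact hL3 k
      _ = ((M' ^ 3 : ℝ≥0) : ℝ≥0∞) := by norm_cast
  · have hmem : MemLp (fun x => v (τ 0) x - b) 3 (volume : Measure (EuclideanSpace ℝ (Fin 3))) :=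
      ⟨hmeas 0, (hL3 0).trans_lt ENNReal.coe_lt_top⟩
    exact tendsto_cube_mul_meas_lt_of_memLp_three hmem

/-- **Hence `L³` recurrence to ONE constant kills, through the weak-`L³` route** (the same conclusion
as hand 2-g0's `…PersistentLpRecurrence` for `p = 3`, re-derived from Albritton–Barker Thm 4.1 with
both slice conditions discharged — a consistency check of the two routes): a member of print's
class P with `‖v(τ_k) − b‖_{L³} ≤ M'` along `τ_k → −∞` is the constant `b`.
[cite: AlbrittonBarker2019, Thm 4.1 (arXiv:1811.00502 §4 p. 9)] -/
theorem oseenMild_const_of_backward_L3_const_via_weakL3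
    (v : ℝ → EuclideanSpace ℝ (Fin 3) → EuclideanSpace ℝ (Fin 3)) (b : EuclideanSpace ℝ (Fin 3))
    (hvc : ContinuousOn (uncurry v) (Iio 0 ×ˢ univ))
    (hvK : ∃ K : ℝ, ∀ t < 0, ∀ x, ‖v t x‖ ≤ K)
    (hvd : ∀ t < 0, IsWeaklyDivFree (v t))
    (hvm : ∀ s t : ℝ, s < t → t < 0 → ∀ x,
      v t x = UnboundedOperators.heatExtension (v s) (t - s) x - oseenDuhamel 1 s v v t x)
    {τ : ℕ → ℝ} {M' : ℝ≥0} (hτ : Tendsto τ atTop atBot) (hτ0 : ∀ k, τ k < 0)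
    (hL3 : ∀ k, eLpNorm (fun x => v (τ k) x - b) 3 (volume : Measure (EuclideanSpace ℝ (Fin 3))) ≤
      (M' : ℝ≥0∞)) :
    ∀ t < 0, ∀ x, v t x = b := by
  have hmeas : ∀ k, AEStronglyMeasurable (fun x => v (τ k) x - b)
      (volume : Measure (EuclideanSpace ℝ (Fin 3))) := by
    intro k
    have h1 : Continuous (v (τ k)) :=
      hvc.comp_continuous (continuous_const.prodMk continuous_id) fun y => ⟨hτ0 k, mem_univ y⟩
    exact (h1.sub continuous_const).aestronglyMeasurable
  obtain ⟨M, k₀, hwk, htail⟩ := weakL3TailRecurrence_of_L3Recurrence_oneConst v b τ hmeas hL3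
  exact oseenMild_const_of_backward_weakL3_const_of_tail v b hvc hvK hvd hvm (M := (M : ℝ≥0∞))
    ENNReal.coe_lt_top hτ hτ0 hwk (k₀ := k₀) htail

end Summit.NavierStokesRegularity.NavierStokesRegularity.Theorems
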